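import Summits.CriticalPhenomena.PercolationContinuityZ3.Theorems.Transplant.KNCellsBoxProdZ2RLevel
import HarnessLib

/-!
# (I3) for the `X □ ℤ²` cells: the LEVEL DATA (planar level along the macro-direction) and p2-g2's `LevelGeom` (`KNCells2FacePrefix`, lag-1
# anchors) for the instance `cellGeom` / `faceData` — the hypothesis `hL` of `samePWitnessAt_of_cellKit₂` / `samePWitnessAt_of_kit₂'`
# (BLUEPRINT-I-PHI §1 row "Lemma 12 / Step IV"; KN p. 31 "to hit `M_x` via `H_{v,x}` you must pass through all the `F^j`")

builds on p205010 (kernel theorem, internal audit signed; external expert review pending) — nothing in this file uses p205010.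
Lane `prim-bschramm`, seat `prim-bschramm-p3` (assigned by p2-g2 09:30Z/09:42Z); helper file (`--supports stmt-CriticalPhenomena-4575 --as helper`).

* uses `levelDataR C` and the planar/product helpers of `KNCellsBoxProdZ2RLevel` (`sep_prodR`, `Face_far'`, …);
* **`levelGeom`** — `LevelGeom (X □ zdGraph 2) (cellGeom X C R a₀ anchor hanch) (faceData X C R) (levelDataR C)`: steps change the level by at
  most one (fibre steps keep it), levels of `Q`, `H \ E^far`, stubs/faces by level, `F^{j+1}` and `M_x` are far, and the three no-edge separations
  `Btw/Cell/Zone` vs `E^far` (any anchors) from `PlanarCellsPSep`.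

[cite: KozmaNitzan2024, §4 p. 31 (Step IV) — the ℤ^d model]
-/

noncomputable section

open scoped Classical

namespace Summit.CriticalPhenomena.PercolationContinuityZ3.Theorems

namespace Transplant

namespace BoxProdZ2

open Literature.Probability.Percolation Literature.Probability.LatticeModels SimpleGraph GadgetSystem Contour KNCells
open Literature.Probability.Percolation.KozmaNitzan.Cells (oth oth_ne sgOf sgOf_sign stepVec_apply_fst stepVec_apply_oth eq_oth_of_ne)
open Literature.Barriers.CriticalPhenomena (graphBall mem_graphBall_self)

variable {W : Type} [DecidableEq W] (X : SimpleGraph W) [X.LocallyFinite]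
variable (C : PCells) (R : ℕ) (a₀ : W) (anchor : W → Site 2 → Finset (Sym2 (W × Site 2)) → W)
  (hanch : ∀ a v P, anchor a v P ∈ ballFin X a R)

omit [DecidableEq W] in
/-- **`LevelGeom` for the `X □ ℤ²` cells.** [cite: KozmaNitzan2024, §4 p. 31 (Step IV)] -/
theorem levelGeom :
    LevelGeom (X □ zdGraph 2) (cellGeom X C R a₀ anchor hanch) (faceData X C R) (levelDataR (W := W) C) where
  adj_le a' v δ y z h := by
    change C.lev δ v z.2 ≤ C.lev δ v y.2 + 1
    rcases (boxProd_adj).1 h with ⟨-, h2⟩ | ⟨h2, -⟩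
    · rw [h2]; omega
    · rcases C.lev_adj δ v h2 with h' | h' | h' <;> omega
  lev_Q a a' v δ _ y hy := C.lev_le_of_mem_Q (Finset.mem_product.1 hy).2
  lev_Hfull a' v δ y hy hn := by
    obtain ⟨h1, h2⟩ := Finset.mem_product.1 hy
    exact lev_le_of_mem_Hfull_not_Efar' C h2 fun h' => hn (Finset.mem_product.2 ⟨h1, h'⟩)
  ℓQ_lt j hj := by
    change 5 * (C.r : ℤ) < 5 * C.r + 10 * C.s * j
    have hs1 : (1 : ℤ) ≤ C.s := by exact_mod_cast C.hs
    have : (1 : ℤ) ≤ j := by exact_mod_cast hj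
    nlinarith
  mem_Stub a' v δ j _ _ y hy hl := by
    obtain ⟨h1, h2⟩ := Finset.mem_product.1 hy
    exact Finset.mem_product.2 ⟨h1, C.mem_Stub_of_mem_Hfull h2 hl⟩
  mem_Face a' v δ j _ _ y hy hl := by
    obtain ⟨h1, h2⟩ := Finset.mem_product.1 hy
    exact Finset.mem_product.2 ⟨h1, C.mem_Face_of_mem_Hfull h2 hl⟩
  Face_far a' v δ j hjK t ht := by
    obtain ⟨h1, h2⟩ := Finset.mem_product.1 ht
    obtain ⟨hE, hl⟩ := Face_far' C (by change j + 1 ≤ C.K at hjK; exact hjK) h2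
    exact ⟨Finset.mem_product.2 ⟨h1, hE⟩, hl⟩
  M_far a' v δ t ht := by
    obtain ⟨h1, h2⟩ := Finset.mem_product.1 ht
    have hl := C.lev_ge_of_mem_M_add (δ := δ) h2
    have hr : (1 : ℤ) ≤ C.r := by exact_mod_cast C.one_le_r
    have hrK : (C.r : ℤ) = C.K * C.s := by simp [PCells.r]
    refine ⟨Finset.mem_product.2 ⟨h1, C.M_add_stepVec_subset_Efar v δ h2⟩, ?_⟩
    change 5 * (C.r : ℤ) + 10 * C.s * (C.K : ℕ) + 1 ≤ C.lev δ v t.2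
    nlinarith
  Btw_sep_Efar a a' w δw du hdu := by
    change KNCells.Sep (X □ zdGraph 2) (ballFin X a R ×ˢ C.Btw w δw) (ballFin X a' R ×ˢ C.Efar (w + stepVec δw) du)
    rw [← C.Btw_rev' w δw]
    exact sep_prodR X (C.Btw_sep_Efar (w + stepVec δw) (Ne.symm hdu))
  Cell_sep_Efar b a' u v δ huv hux := sep_prodR X (C.Cell_sep_Efar huv hux)
  Zone_sep_Efar b a' u δ' v δ huv hux := sep_prodR X (C.Zone_sep_Efar huv hux δ')

end BoxProdZ2

end Transplant

end Summit.CriticalPhenomena.PercolationContinuityZ3.Theorems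

end
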